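import Summits.BirchSwinnertonDyer.BirchSwinnertonDyer.Theorems.ManinLocalTwoThreeStevensCuspValues
import Summits.BirchSwinnertonDyer.BirchSwinnertonDyer.Theorems.ManinLocalTwoThreeStevensYPresentation
import Literature.NumberTheory.EllipticCurves.EichlerIntegralPolesProofs
import HarnessLib

/-!
# Values of the uniformising coordinates at a cusp as limits of quotients of translates (toward Stevens 1982 Thm 1.3.1 (b))
(route `ManinLocalTwoThree`, crux C2 `ManinOddAtFour` stmt-BirchSwinnertonDyer-22967; cell bsd-f2-manin, prover seat p1 gen 22;
`--supports stmt-BirchSwinnertonDyer-22967`; sequel of `…StevensCuspValues`, `…StevensYPresentation`)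

Let `f ∈ S₂(Γ₀(N))` be nonzero, `L` a lattice, `X = ℘_L(ℰ_f)` presented as `X·H = A` off the poles by holomorphic `A, H` of weight
`K`, and `γ ∈ SL₂(ℤ)` with `γ∞ = a/c` a finite cusp (`c ≠ 0`).  High in the cusp `γ·i∞` one has `ℰ_f(γτ) = {∞, a/c}_f + V_γ(τ)`
with `V_γ → 0` (Manin; the tree's `modularSymbol_smul_infty`), so the quotient of the translates `(A ∣ γ)(τ)/(H ∣ γ)(τ) =
℘_L({∞,a/c}_f + V_γ(τ))` tends to `℘_L({∞,a/c}_f)` if `{∞,a/c}_f ∉ Λ`, and blows up if `{∞,a/c}_f ∈ Λ` (double pole of `℘_L`);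
likewise the bracket quotient `(H·ϑA − A·ϑH) ∣ γ / (f·H²) ∣ γ → ℘'_L({∞,a/c}_f)`.  These are the analytic halves of the reading of
the cusp value `u(c_D·{∞, a/c}_f)` of a modular parametrisation off `q`-expansions of translates (Stevens 1982, §1.3).

* `eventually_slash_ne_zero` — a nonzero `H ∈ M_K(Γ(N))` has `(H ∣ γ)(τ) ≠ 0` high in the cusp;
* `tendsto_slash_div_slash_weierstrassP` / `tendsto_norm_slash_div_slash_atTop` — the `x`-quotient: limit `℘_L(z)` (`z ∉ Λ`) / blow-up (`z ∈ Λ`);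
* `tendsto_bracket_div_weierstrassP'` — the `y`-quotient: limit `℘'_L(z)` (`z ∉ Λ`).

No definitions, no sorry.  BSD is not proved by this file; C2 is not proved by this file.
[cite: Stevens1982, §1.3 Thm. 1.3.1] [cite: Manin1972, Prop. 1.4] [cite: DiamondShurman2005, §3.2]
-/

set_option linter.dupNamespace false
set_option autoImplicit false

noncomputable section

open Complex Filter Topology Set Function PowerSeries
open UpperHalfPlane hiding I
open scoped Real Topology Manifold MatrixGroups PeriodPair ModularForm
open ModularForm CongruenceSubgroup Derivative
open Literature.NumberTheory.EllipticCurves Literature.NumberTheory.EllipticCurves.ModularForms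

namespace Summit.BirchSwinnertonDyer.BirchSwinnertonDyer.Theorems.ManinLocalTwoThree.StevensGalois

variable {N : ℕ} [NeZero N]

/-! ## §1 Non-vanishing high in the cusp -/

/-- **A nonzero `H ∈ M_K(Γ(N))` does not vanish high in the cusp** (its `q_N`-expansion is nonzero; leading term).
[cite: DiamondShurman2005, §3.2] -/
theorem eventually_ne_zero_of_mem_formSpace {K : ℤ} {H : ℍ → ℂ}
    (hH : H ∈ formSpace (CongruenceSubgroup.Gamma N : Subgroup (GL (Fin 2) ℝ)) K) (hH0 : H ≠ 0) :
    ∀ᶠ τ : ℍ in atImInfty, H τ ≠ 0 := by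
  classical
  have hN : (0 : ℝ) < N := Nat.cast_pos.mpr (NeZero.pos N)
  obtain ⟨F, rfl⟩ := hH
  have hq0 : qExpansion (N : ℝ) ⇑F ≠ 0 := fun h0 ↦ hH0 (congrArg DFunLike.coe
    ((ModularForm.qExpansion_eq_zero_iff hN (Literature.NumberTheory.ModularForms.natCast_mem_strictPeriods_Gamma N) F).mp h0))
  have hex : ∃ m, (qExpansion (N : ℝ) ⇑F).coeff m ≠ 0 := by
    by_contra! hall
    exact hq0 (PowerSeries.ext fun m ↦ by rw [hall m, map_zero])
  set n₀ := Nat.find hex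
  have hn₀ : (qExpansion (N : ℝ) ⇑F).coeff n₀ ≠ 0 := Nat.find_spec hex
  have hlt : ∀ i < n₀, (qExpansion (N : ℝ) ⇑F).coeff i = 0 := fun i hi ↦ by
    have := Nat.find_min hex hi; simpa using this
  have hlim := tendsto_div_qParam_pow_coeff hN
    (SlashInvariantFormClass.periodic_comp_ofComplex F (Literature.NumberTheory.ModularForms.natCast_mem_strictPeriods_Gamma N))
    (ModularFormClass.holo F) (ModularFormClass.bdd_at_infty F) n₀ hlt
  filter_upwards [hlim.eventually_ne hn₀] with τ hτ h0
  exact hτ (by rw [h0, zero_div])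

/-- Translates of forms on `Γ(N)` are forms on `Γ(N)` (`Γ(N)` is normal); copy of `GammaTranslatesSetup.slash_mem_formSpace_Gamma`. [folklore] -/
private theorem slash_mem_formSpace_Gamma'' {k : ℤ} {f : ℍ → ℂ}
    (hf : f ∈ formSpace (CongruenceSubgroup.Gamma N : Subgroup (GL (Fin 2) ℝ)) k) (γ : SL(2, ℤ)) :
    f ∣[k] γ ∈ formSpace (CongruenceSubgroup.Gamma N : Subgroup (GL (Fin 2) ℝ)) k := by
  have hf' := hf
  obtain ⟨F, hF⟩ := hf'
  rw [mem_formSpace_iff] at hf ⊢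
  obtain ⟨-, hinv, hbdd⟩ := hf
  refine ⟨?_, ?_, ?_⟩
  · rw [← hF]
    exact (ModularForm.translate F (γ : GL (Fin 2) ℝ)).holo'
  · intro δ hδ
    obtain ⟨g, hg, rfl⟩ := hδ
    have hconj : γ * g * γ⁻¹ ∈ CongruenceSubgroup.Gamma N :=
      (CongruenceSubgroup.Gamma_normal N).conj_mem g hg γ
    have h1 : f ∣[k] (γ * g * γ⁻¹) = f :=
      hinv (Matrix.SpecialLinearGroup.mapGL ℝ (γ * g * γ⁻¹)) ⟨_, hconj, rfl⟩
    show (f ∣[k] γ) ∣[k] g = f ∣[k] γ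
    rw [← SlashAction.slash_mul, show γ * g = (γ * g * γ⁻¹) * γ by group, SlashAction.slash_mul, h1]
  · intro g
    have := hbdd (γ * g)
    show IsBoundedAtImInfty ((f ∣[k] γ) ∣[k] g)
    rw [← SlashAction.slash_mul]
    exact this

omit [NeZero N] in
/-- Slashing by a fixed `γ` is injective on functions. [folklore] -/
private theorem slash_ne_zero {k : ℤ} {f : ℍ → ℂ} (hf : f ≠ 0) (γ : SL(2, ℤ)) : f ∣[k] γ ≠ 0 := by
  intro h0
  apply hf
  have := congrArg (fun g : ℍ → ℂ ↦ g ∣[k] γ⁻¹) h0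
  simpa only [← SlashAction.slash_mul, mul_inv_cancel, SlashAction.slash_one, SlashAction.zero_slash] using this

/-- **`(H ∣ γ)(τ) ≠ 0` high in the cusp** for a nonzero `H ∈ M_K(Γ(N))`. [cite: DiamondShurman2005, §3.2] -/
theorem eventually_slash_ne_zero {K : ℤ} {H : ℍ → ℂ}
    (hH : H ∈ formSpace (CongruenceSubgroup.Gamma N : Subgroup (GL (Fin 2) ℝ)) K) (hH0 : H ≠ 0) (γ : SL(2, ℤ)) :
    ∀ᶠ τ : ℍ in atImInfty, (H ∣[K] γ) τ ≠ 0 :=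
  eventually_ne_zero_of_mem_formSpace (slash_mem_formSpace_Gamma'' hH γ) (slash_ne_zero hH0 γ)

/-! ## §2 The `x`-quotient at a finite cusp -/

/-- **The `x`-quotient converges at a regular cusp.**  If `℘_L(ℰ_f)·H = A` off the poles (`H ∈ M_K(Γ(N))` nonzero),
`γ₁₀ ≠ 0` and `z = {∞, γ₀₀/γ₁₀}_f ∉ Λ`, then `(A ∣ γ)(τ)/(H ∣ γ)(τ) → ℘_L(z)` at `i∞`.
[cite: Stevens1982, §1.3] [cite: Manin1972, Prop. 1.4] -/
theorem tendsto_slash_div_slash_weierstrassP (f : CuspForm (Gamma0 N) 2) (hf : f ≠ 0) (L : PeriodPair) {K : ℤ}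
    {A H : ℍ → ℂ} (hH : H ∈ formSpace (CongruenceSubgroup.Gamma N : Subgroup (GL (Fin 2) ℝ)) K) (hH0 : H ≠ 0)
    (hAeq : ∀ τ : ℍ, eichlerIntegral f τ ∉ L.lattice → ℘[L] (eichlerIntegral f τ) * H τ = A τ)
    (γ : SL(2, ℤ)) (hγ : (γ 1 0 : ℤ) ≠ 0)
    (hz : modularSymbol f (((γ 0 0 : ℤ) : ℚ) / ((γ 1 0 : ℤ) : ℚ)) ∉ L.lattice) :
    Tendsto (fun τ : ℍ ↦ (A ∣[K] γ) τ / (H ∣[K] γ) τ) atImInfty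
      (𝓝 (℘[L] (modularSymbol f (((γ 0 0 : ℤ) : ℚ) / ((γ 1 0 : ℤ) : ℚ))))) := by
  set z := modularSymbol f (((γ 0 0 : ℤ) : ℚ) / ((γ 1 0 : ℤ) : ℚ)) with hzdef
  set V := verticalIntegral (⇑f ∣[(2 : ℤ)] γ) with hV
  have hE : ∀ τ : ℍ, eichlerIntegral f (γ • τ) = z + V τ := fun τ ↦ by
    rw [hzdef, modularSymbol_smul_infty f γ hγ τ]; ring
  have hV0 : Tendsto V atImInfty (𝓝 0) := (isCuspFunction_verticalIntegral_slash f γ).isZeroAtImInfty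
  obtain ⟨T, hT⟩ := exists_forall_eichlerIntegral_smul_notMem f hf L γ
  -- `℘_L` is continuous at `z`
  have hcont : ContinuousAt ℘[L] z := (L.hasDerivAt_weierstrassP_of_notMem hz).continuousAt
  have hlim : Tendsto (fun τ : ℍ ↦ ℘[L] (z + V τ)) atImInfty (𝓝 (℘[L] z)) := by
    have h1 : Tendsto (fun τ : ℍ ↦ z + V τ) atImInfty (𝓝 z) := by simpa using hV0.const_add z
    exact hcont.tendsto.comp h1
  refine hlim.congr' ?_
  filter_upwards [(atImInfty_mem _).mpr ⟨T, fun _ h ↦ h⟩, eventually_slash_ne_zero hH hH0 γ] with τ hτ hHτ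
  have hd : denom (γ : SL(2, ℤ)) τ ≠ 0 := denom_ne_zero _ τ
  have hΛ := hT τ hτ
  rw [ModularForm.SL_slash_apply] at hHτ ⊢
  rw [ModularForm.SL_slash_apply, ← hAeq (γ • τ) hΛ, hE τ]
  have hH' : H (γ • τ) ≠ 0 := fun h0 ↦ hHτ (by rw [h0, zero_mul])
  field_simp

/-- **The `x`-quotient blows up at a cusp mapping to the origin.**  Under the same hypotheses, if `z = {∞, γ₀₀/γ₁₀}_f ∈ Λ` then
`‖(A ∣ γ)(τ)/(H ∣ γ)(τ)‖ → ∞` at `i∞` (`℘_L(z + V) = ℘_L(V)`, double pole at `0`).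
[cite: Stevens1982, §1.3] [cite: Manin1972, Prop. 1.4] -/
theorem tendsto_norm_slash_div_slash_atTop (f : CuspForm (Gamma0 N) 2) (hf : f ≠ 0) (L : PeriodPair) {K : ℤ}
    {A H : ℍ → ℂ} (hH : H ∈ formSpace (CongruenceSubgroup.Gamma N : Subgroup (GL (Fin 2) ℝ)) K) (hH0 : H ≠ 0)
    (hAeq : ∀ τ : ℍ, eichlerIntegral f τ ∉ L.lattice → ℘[L] (eichlerIntegral f τ) * H τ = A τ)
    (γ : SL(2, ℤ)) (hγ : (γ 1 0 : ℤ) ≠ 0)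
    (hz : modularSymbol f (((γ 0 0 : ℤ) : ℚ) / ((γ 1 0 : ℤ) : ℚ)) ∈ L.lattice) :
    Tendsto (fun τ : ℍ ↦ ‖(A ∣[K] γ) τ / (H ∣[K] γ) τ‖) atImInfty atTop := by
  set z := modularSymbol f (((γ 0 0 : ℤ) : ℚ) / ((γ 1 0 : ℤ) : ℚ)) with hzdef
  set V := verticalIntegral (⇑f ∣[(2 : ℤ)] γ) with hV
  have hE : ∀ τ : ℍ, eichlerIntegral f (γ • τ) = z + V τ := fun τ ↦ by
    rw [hzdef, modularSymbol_smul_infty f γ hγ τ]; ring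
  have hV0 : Tendsto V atImInfty (𝓝 0) := (isCuspFunction_verticalIntegral_slash f γ).isZeroAtImInfty
  obtain ⟨T, hT⟩ := exists_forall_eichlerIntegral_smul_notMem f hf L γ
  -- `V τ ≠ 0` high up (else `ℰ_f(γτ) = z ∈ Λ`)
  have hVne : ∀ᶠ τ : ℍ in atImInfty, V τ ≠ 0 := by
    filter_upwards [(atImInfty_mem _).mpr ⟨T, fun _ h ↦ h⟩] with τ hτ h0
    have := hT τ hτ
    rw [hE τ, h0, add_zero] at this
    exact this hz
  have hVnhds : Tendsto V atImInfty (𝓝[≠] 0) := tendsto_nhdsWithin_iff.mpr ⟨hV0, hVne⟩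
  have hord : meromorphicOrderAt ℘[L] 0 < 0 := by
    rw [L.order_weierstrassP 0 L.lattice.zero_mem]; decide
  have h℘ := tendsto_cobounded_of_meromorphicOrderAt_neg hord
  rw [← tendsto_norm_atTop_iff_cobounded] at h℘
  have hlim : Tendsto (fun τ : ℍ ↦ ‖℘[L] (V τ)‖) atImInfty atTop := h℘.comp hVnhds
  refine hlim.congr' ?_
  filter_upwards [(atImInfty_mem _).mpr ⟨T, fun _ h ↦ h⟩, eventually_slash_ne_zero hH hH0 γ] with τ hτ hHτ
  have hd : denom (γ : SL(2, ℤ)) τ ≠ 0 := denom_ne_zero _ τ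
  have hΛ := hT τ hτ
  rw [ModularForm.SL_slash_apply] at hHτ
  rw [ModularForm.SL_slash_apply, ModularForm.SL_slash_apply, ← hAeq (γ • τ) hΛ, hE τ]
  have hH' : H (γ • τ) ≠ 0 := fun h0 ↦ hHτ (by rw [h0, zero_mul])
  have hper : ℘[L] (z + V τ) = ℘[L] (V τ) := by
    rw [add_comm]
    exact L.weierstrassP_add_coe (V τ) ⟨z, hz⟩
  congr 1
  rw [← hper]
  field_simp

/-! ## §3 The `y`-quotient at a regular cusp -/

/-- **The `y`-quotient converges at a regular cusp.**  With the bracket `B = H·ϑA − A·ϑH` and `H_Y = f·H²` (weight `K + (K+2)`):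
if `℘_L(ℰ_f)·H = A` off the poles, `H` holomorphic, `H, f` nonvanishing high in the cusp `γ·i∞`, and `z = {∞,γ₀₀/γ₁₀}_f ∉ Λ`, then
`(B ∣ γ)(τ)/(H_Y ∣ γ)(τ) → ℘'_L(z)`. [cite: Stevens1982, §1.3] [cite: CremonaAlgorithms1997, §2.10] -/
theorem tendsto_bracket_div_weierstrassP' (f : CuspForm (Gamma0 N) 2) (hf : f ≠ 0) (L : PeriodPair) {K : ℤ}
    {A H : ℍ → ℂ} (hH : H ∈ formSpace (CongruenceSubgroup.Gamma N : Subgroup (GL (Fin 2) ℝ)) K) (hH0 : H ≠ 0)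
    (hAeq : ∀ τ : ℍ, eichlerIntegral f τ ∉ L.lattice → ℘[L] (eichlerIntegral f τ) * H τ = A τ)
    (γ : SL(2, ℤ)) (hγ : (γ 1 0 : ℤ) ≠ 0)
    (hz : modularSymbol f (((γ 0 0 : ℤ) : ℚ) / ((γ 1 0 : ℤ) : ℚ)) ∉ L.lattice) :
    Tendsto (fun τ : ℍ ↦ ((H * serreDerivative K A - A * serreDerivative K H) ∣[K + (K + 2)] γ) τ /
        ((⇑f * H ^ 2) ∣[K + (K + 2)] γ) τ) atImInfty
      (𝓝 (℘'[L] (modularSymbol f (((γ 0 0 : ℤ) : ℚ) / ((γ 1 0 : ℤ) : ℚ))))) := by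
  set z := modularSymbol f (((γ 0 0 : ℤ) : ℚ) / ((γ 1 0 : ℤ) : ℚ)) with hzdef
  set V := verticalIntegral (⇑f ∣[(2 : ℤ)] γ) with hV
  have hE : ∀ τ : ℍ, eichlerIntegral f (γ • τ) = z + V τ := fun τ ↦ by
    rw [hzdef, modularSymbol_smul_infty f γ hγ τ]; ring
  have hV0 : Tendsto V atImInfty (𝓝 0) := (isCuspFunction_verticalIntegral_slash f γ).isZeroAtImInfty
  obtain ⟨T, hT⟩ := exists_forall_eichlerIntegral_smul_notMem f hf L γ
  have hHhol : MDifferentiable 𝓘(ℂ) 𝓘(ℂ) H := by obtain ⟨F, rfl⟩ := hH; exact ModularFormClass.holo F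
  -- `℘'_L` is continuous at `z`
  have hcont : ContinuousAt ℘'[L] z :=
    (L.differentiableOn_derivWeierstrassP.differentiableAt (L.isClosed_lattice.isOpen_compl.mem_nhds hz)).continuousAt
  have hlim : Tendsto (fun τ : ℍ ↦ ℘'[L] (z + V τ)) atImInfty (𝓝 (℘'[L] z)) := by
    have h1 : Tendsto (fun τ : ℍ ↦ z + V τ) atImInfty (𝓝 z) := by simpa using hV0.const_add z
    exact hcont.tendsto.comp h1
  refine hlim.congr' ?_
  -- `f` does not vanish high in the cusp `γ·i∞`
  have hfmem : (⇑f : ℍ → ℂ) ∈ formSpace (CongruenceSubgroup.Gamma N : Subgroup (GL (Fin 2) ℝ)) 2 :=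
    formSpace_mono (Subgroup.map_mono ((Gamma_le_Gamma1 N).trans (Gamma1_in_Gamma0 N))) ⟨(f : ModularForm (Gamma0 N) 2), rfl⟩
  have hf0 : (⇑f : ℍ → ℂ) ≠ 0 := fun h0 ↦ hf (DFunLike.ext f 0 fun τ ↦ congrFun h0 τ)
  filter_upwards [(atImInfty_mem _).mpr ⟨T, fun _ h ↦ h⟩, eventually_slash_ne_zero hH hH0 γ,
    eventually_slash_ne_zero hfmem hf0 γ] with τ hτ hHτ hfτ
  have hd : denom (γ : SL(2, ℤ)) τ ≠ 0 := denom_ne_zero _ τ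
  have hΛ := hT τ hτ
  rw [ModularForm.SL_slash_apply] at hHτ hfτ
  have hH' : H (γ • τ) ≠ 0 := fun h0 ↦ hHτ (by rw [h0, zero_mul])
  have hf' : f (γ • τ) ≠ 0 := fun h0 ↦ hfτ (by rw [h0, zero_mul])
  rw [ModularForm.SL_slash_apply, ModularForm.SL_slash_apply, bracket_eq_derivWeierstrassP_mul f L hHhol hAeq hΛ, hE τ]
  simp only [Pi.mul_apply, Pi.pow_apply]
  field_simp

end Summit.BirchSwinnertonDyer.BirchSwinnertonDyer.Theorems.ManinLocalTwoThree.StevensGalois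

end
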